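import Mathlib
import HarnessLib
import HarnessLib.Audit
import Summits.ValiantsHypothesis.Statement
import Literature.Barriers.ValiantsHypothesis.MonotoneGap
import Literature.Computability.AlgebraicComplexity.ValiantConjectureProofs
import Summits.ValiantsHypothesis.ValiantsHypothesis.Theorems.HubHub
import HarnessLib.Audit.Status.Attr

/-!
Route: HartogsRankTwo

# Route HartogsRankTwo — Hartogs is expensive — the permanent has no cheap polynomial representative
on rank-two matrices (coset hardness modulo 3×3 minors)

It suffices to show HARTOGS(2) (card hartogs-on-rank-two, item K1): there is no p-bounded family of
POLYNOMIALS P_n ∈ ℂ[X_n]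
agreeing with per_n on the rank-two determinantal variety D_2 = {U Vᵀ : U, V ∈ ℂ^{n×2}} —
equivalently (Second Fundamental
Theorem for GL_2 / primality of the ideal I_3 of 3×3 minors, filed as support KernelIsMinors) no
element of the coset per_n + I_3
has polynomial-size circuits. On D_2 the permanent is RATIONALLY easy (Barvinok: per(UVᵀ) = Σ_k
k!(n−k)! E_k(u,w)E_k(a,b), size
O(n²) in the factors; pivoting on a 2×2 minor δ gives δ^n·per ≡ Q mod I_3 with L(Q) = poly(n)) but —
thesis — POLYNOMIALLY hard:
division by the pivot minor cannot be eliminated on the singular normal cone D_2, whose charts all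
die on D_1 (codimension 2n−3),
across which per extends by Hartogs/normality only at super-polynomial cost. Since per_n lies in its
own coset, X is strictly
stronger than per ∉ VP_ℂ and the assembly is one line through the hub.
Lean: `¬ ∃ c : ℕ, ∀ n : ℕ, ∃ P : MvPolynomial (Fin n × Fin n) ℂ, (∀ U V : Fin n → Fin 2 → ℂ,
MvPolynomial.eval (fun ij : Fin n × Fin n => ∑ t : Fin 2, U ij.1 t * V ij.2 t) P = MvPolynomial.eval
(fun ij : Fin n × Fin n => ∑ t : Fin 2, U ij.1 t * V ij.2 t)
(Literature.Computability.AlgebraicComplexity.perPoly (Fin n) ℂ)) ∧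
Literature.Computability.AlgebraicComplexity.complexity P ≤ n ^ c + c`

## Assembly
Pure logic over PROVED tree facts (sorry-free in Sketch.lean, and it is the deciding theorem
`closes` of glue.lean): if per were a
VP family over ℂ, IsPComputable gives c with L(per_n) ≤ n^c + c for all n, and P := per_n agrees
with itself on D_2 (rfl), contradicting
HartogsTwo; so ¬ IsVPFamily (perPoly (Fin n) ℂ), and the hub theorem
Summit.ValiantsHypothesis.Hub.valiantsHypothesis_of_not_isVPFamily_per
with mem_VP_ofFintype_iff_holds and perFamily_mem_VNP_holds ℂ gives VP_ℂ ≠ VNP_ℂ. The cruxes are the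
engine (PoleOrderTradeoff →
HartogsTwo via TradeoffToHartogs), the isolated phenomenon (TransferFailsGLTwo, necessary for
HartogsTwo given FactorSideEasy) and the
monotone rung; the supports are the proved-now rungs and the two halves of "rationally easy".

Rationale: WHY THIS LINE. COSET AVOIDANCE: for any ideals I_n, "no element of per_n + I_n is cheap" implies VP
≠ VNP, and enlarging I strengthens the claim
while handing it structure; I_3 is the largest interesting choice (I_2 already contains per −
n!·x_11⋯x_nn, so c_1(n) = O(n)), and
modulo I_3 the permanent is the n-th transvectant of two completely split binary n-ics — classical
invariant theory of n points on
P¹ (Weyl1939 FFT/SFT, Kempe/HMSV arXiv:math/0505096) with 150 years of tooling. The engine imported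
from computer algebra is
DIVISION ELIMINATION (Strassen1973, Kaltofen1989) and its transfer form for invariant rings
(BlaserJindal2019 for S_n via Newton
iteration; ChauguleKumarLimayeMohapatraSheSrinivasan2020 Lemma 4 for "well-behaved ALGEBRAICALLY
INDEPENDENT" generators): both need
the quotient to be affine space / the generator map to be submersive somewhere useful, and the
generators x_ij = ⟨u_i,v_j⟩ are
dependent (3×3 minors) with D_2 singular along D_1 — the thesis bets that this failure is real and
is ALREADY visible for per
(crux PoleOrderTradeoff quantifies it as a pole-order/size tradeoff along D_1; crux
TransferFailsGLTwo isolates it as a statement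
about GL_2-invariants). From commutative algebra it imports the standard-bitableau/straightening
technology of determinantal rings
(BrunsVetter1988, DeConciniEisenbudProcesi1980) that Andrews–Forbes (arXiv:2112.00792) turned into
complexity lower bounds for
determinantal IDEALS; here the object is a COSET of I_3, for which the route already has
model-by-model rungs (support RobustSparsity:
≥ C(n,⌊n/2⌋) monomials for every representative; crux RobustMonotoneRung: robust Jerrum–Snir over
ℝ≥0, resting on the PROVED cone
fact JerrumSnir1982_permanent_holds). No prior route touches input-side varieties: projections to
linear slices (ImmanantSlice,
group permanents) stay VNP-complete, and low rank appears elsewhere only as Barvinok's EASY island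
(card borchardt-island); the
negatives index (Elusive Sidon curve, GrenetRigidity uniqueness) is disjoint from this line.

RANKED CRUXES. #0 HartogsTwo (target) — HARTOGS(2): there is no c such that for every n some
polynomial P with L(P) ≤ n^c + c agrees with per_n on all rank-≤2 matrices U Vᵀ (U, V ∈ ℂ^{n×2});
i.e. the representative complexity c_2(n) = min{L(P) : P ≡ per_n mod I_3} is not p-bounded (card
K1). (why it might fail: One poly-size division-free SLP agreeing with per_n on rank-2 matrices
kills it: Kempe/bracket straightening of the transvectant Σ_k k!(n−k)!E_k(u,w)E_k(a,b) with
cancellations, or gluing the O(n⁴) pivot charts by a syzygy of the 2×2 minors.) [Barvinok1996,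
ArvindChatterjeeDattaMukhopadhyay2018, Strassen1973, BlaserJindal2019, arXiv:2112.00792]
#2 PoleOrderTradeoff (crux) — POLE-ORDER/SIZE TRADEOFF along D_1 (card K2, the quantitative engine):
there is C such that for all n, N and every polynomial Q on (n+2)×(n+2) matrices agreeing with
δ^N·per_{n+2} on D_2, where δ = x_00x_11 − x_01x_10 is the pivot minor, one has n ≤ N + C·(log₂ L(Q)
+ 1) — lowering the pole order along D_1 by t below the chart value costs size 2^{Ω(t)}; at N = 0
every representative of per has size 2^{Ω(n)}, so this implies HartogsTwo (support
TradeoffToHartogs). [difficulty: open-problem] (why it might fail: Claims 2^{Ω(n−N)}, i.e.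
exponential (not just superpolynomial) hardness at N=0; a partial-fraction/syzygy identity among the
C(n,2)² pivot charts (each of pole order exactly n: bidegree count p+q−2m=1) might lower N in big
steps at polynomial cost.) [Strassen1973, Kaltofen1989, BrunsVetter1988, arXiv:2112.00792,
Barvinok1996]
#3 TransferFailsGLTwo (crux) — GL_2 TRANSFER FAILS (the isolated phenomenon; its negation is a
Bläser–Jindal-type transfer theorem for the reductive group GL_2 and kills the route): there is a
p-family F_n ∈ ℂ[X_n] of p-bounded degree whose pullback F_n(U Vᵀ) ∈ ℂ[U,V] (a GL_2-invariant, U,V ∈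
ℂ^{n×2}) has p-bounded circuit complexity, while no p-bounded family of polynomials in X agrees with
F_n on D_2. Implied by HartogsTwo ∧ FactorSideEasy with F = per. [difficulty: open-problem] (why it
might fail: A transfer theorem for the dependent generators x_ij=⟨u_i,v_j⟩ — Newton iteration along
smooth points of D_2 plus a cheap Hartogs extension across D_1 (codim 2n−3; ℂ[D_2] is normal
Cohen–Macaulay with explicit straightening) — would refute it.) [BlaserJindal2019,
ChauguleKumarLimayeMohapatraSheSrinivasan2020, GargIkenmeyerMakamOliveiraWalterWigderson2020,
Weyl1939, Strassen1973]
#4 RobustMonotoneRung (crux) — ROBUST JERRUM–SNIR (card K3, the monotone rung of the coset): there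
are ε > 0 and n₀ such that for n ≥ n₀, every Jerrum–Snir monotone computation (plain ⊕/⊗ circuit
over ℝ≥0) of a polynomial f ∈ ℝ≥0[X_n] that agrees with per_n on all NONNEGATIVE rank-≤2 matrices
has ⊗-count ≥ 2^{εn}. For f = per_n this is the proved cone fact JerrumSnir1982_permanent
(n(2^{n−1}−1)); nonnegative representatives are exactly the GMFs d_p with p ≥ 0 rectangle-uniform
(e.g. per + det = 2·Σ_{A_n}), so the claim is a content bound uniform over that polytope. [deps:
RectangleCriterion] [difficulty: L] (why it might fail: A structured rectangle-uniform p ≥ 0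
(iterated-wreath or design-like support of size ~C(n,n/2)·poly) might let parse trees be shared
below 2^{εn}; JS's content argument is proved only for supp p = S_n (per) and HC.) [JerrumSnir1982,
doi:10.1016/s0304-3975(98)00130-3, Valiant1980, arXiv:2112.00792]
#9 RectangleCriterion (support) — (card P1, elementary form) a generalized matrix function d_q = Σ_σ
q(σ) Π_i x_{σ(i),i} vanishes on D_2 iff every rectangle sum Σ_{σ : σ(A) = B} q(σ) (|A| = |B|)
vanishes — the coefficient of a_A b_{A^c} u_B w_{B^c} in d_q(UVᵀ) is exactly that sum. Hence P ≡ per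
mod I_3 forces the (1ⁿ,1ⁿ)-weight part d_p of P to have all k-rectangle sums equal to k!(n−k)!.
[difficulty: provable-now] [Barvinok1996, MarcusMinc1961]
#9 RobustSparsity (support) — (card P2) every polynomial agreeing with per_n on D_2 has at least
C(n,⌊n/2⌋) monomials: I(D_2) is homogeneous for the row/column torus grading, so the (1ⁿ,1ⁿ)-weight
part of P is a GMF d_p ≡ per mod I_3; by RectangleCriterion, for a fixed ⌊n/2⌋-set A the images
σ(A), σ ∈ supp p, cover all ⌊n/2⌋-sets (tight at n = 3: 2(x_12x_21x_33 + x_13x_22x_31 +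
x_11x_23x_32) = per − det). [difficulty: provable-now] [arXiv:2112.00792, JerrumSnir1982,
MarcusMinc1961]
#9 FactorSideEasy (support) — (card P4a, the RATIONALLY-EASY half; Barvinok's rank-two permanent)
the pullback per_n(U Vᵀ) ∈ ℂ[U,V] = Σ_k k!(n−k)!·E_k(u,w)·E_k(a,b), E_k(u,w) = [s^k]Π_i(s·u_i +
w_i), has p-bounded circuit complexity (size O(n²)). [difficulty: M] [Barvinok1996,
ArvindChatterjeeDattaMukhopadhyay2018, Burgisser2000]
#9 PivotChart (support) — (card P4b, the chart) pivoting on δ = x_00x_11 − x_01x_10: with U' =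
X_{·,{0,1}} and V'ᵀ = adj(X_{{0,1},{0,1}})·X_{{0,1},·}, the polynomial Q = Σ_k
k!(n+2−k)!·E_k(U')·E_k(V') has circuit size poly(n) and agrees with δ^{n+2}·per_{n+2} on D_2 (on δ ≠
0 by X = U'(X_{01,01})^{-1}X_{01,·}, then by density); so the pole order n+2 is attained cheaply and
PoleOrderTradeoff is sharp at its top. [difficulty: M] [Barvinok1996, Strassen1973, Burgisser2000]
#9 KernelIsMinors (support) — (dictionary to the card's ideal language; Second Fundamental Theorem
for GL_2 = primality of I_3, Hochster–Eagon / De Concini–Eisenbud–Procesi / Bruns–Vetter Thm 2.10) a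
polynomial vanishes on D_2 = {U Vᵀ} iff it lies in the ideal generated by the 3×3 minors of the
generic n×n matrix; so "agrees with per on D_2" = "≡ per mod I_3" throughout the route. [difficulty:
L] [BrunsVetter1988, DeConciniEisenbudProcesi1980, HochsterEagon1971, Weyl1939]
#9 TradeoffToHartogs (support) — (glue) PoleOrderTradeoff at pole order N = 0 and size n+2 bounds
every representative of per_{n+2} below by 2^{n/C−1}, which beats (n+2)^c + c eventually; hence
HartogsTwo. [difficulty: provable-now] [Burgisser2000]

TWO-LAYER PLAN. Foreseen glued splits (k ≤ 3, depth 1), filed only after a crux moves: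
RobustMonotoneRung ⇐ NonnegRepsAreGMF (a nonnegative
representative is a GMF d_p with p ≥ 0 and all k-rectangle sums k!(n−k)!, by the torus grading +
RectangleCriterion + "no nonzero
nonnegative polynomial vanishes on nonnegative rank-2 points") → UniformContentBound (JS
content/degree bound for every such d_p) →
RobustMonotoneRung. PoleOrderTradeoff ⇐ OneStepDrop (a representative of δ^{N−1}per of size s yields
one of δ^N per of size ≤ s + O(n²),
trivial, and conversely dropping one power of δ multiplies size by ≥ 1+ε — the real content) →
induction from PivotChart. HartogsTwo
direct ⇐ TradeoffToHartogs ∘ PoleOrderTradeoff, or ⇐ a homogeneous/GMF reduction if one is found at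
polynomial cost (not automatic:
extracting the (1ⁿ,1ⁿ)-weight part of Π_i(Σ_j x_ij) is per itself).

KILL CRITERIA. ¬HartogsTwo (a p-bounded family of representatives, e.g. an explicit SLP verified on
random rank-2 points and then proved) closes the
route `refuted:HartogsTwo`; the successor is a NEW route at r = 3 (HARTOGS(3), representatives
modulo 4×4 minors, same rungs with
C(n; n/3,n/3,n/3)), not a repair. ¬TransferFailsGLTwo (a GL_2 transfer theorem) kills HartogsTwo as
well (with FactorSideEasy) — same
close. ¬PoleOrderTradeoff alone (big-step pole lowering, or 2^{o(n)} circuits for per) forces a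
pivot: re-rank with HartogsTwo served
directly and a quasi-polynomial restatement of the tradeoff. ¬RobustMonotoneRung (a monotone-cheap
nonnegative representative) is
informative, not fatal: drop the rung, record the witness p as a candidate cheap coset direction for
refuters of HartogsTwo.
per ∉ VP proved elsewhere moots the route (HartogsTwo stays open as a stronger statement).

NOT DECOMPOSED YET. The r-ladder HARTOGS(r), 3 ≤ r ≤ n−1 (c_r non-decreasing; top rung "per + g·det
is never cheap") — fallback theses, not items.
The card's Fourier refinement (which rays of the two-row cone Σ_{ℓ(λ)≤2} have cheap representatives;
n!·x_11⋯x_nn has data (f^λ))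
is left to route ImmanantSlice. The Nisan/ROABP rung (width ≥ C(n,⌊n/2⌋) for every representative,
card P3) needs an ordered-ABP
notion the tree lacks — later, as a child of RobustSparsity's genre. Constants in PoleOrderTradeoff
(the true base of the
exponential), the orthogonal-coset sibling (per + (XXᵀ − I), Kogan's char-3 collapse) and any
border/approximative version are not
decomposed. Definitions cosetComplexity / determinantalIdeal are requested, not assumed: every item
is stated inline over existing decls.

CHEAPEST FALSIFIER. A poly(n)-size division-free SLP over ℤ computing SOME P_n with P_n = per_n on
random rank-2 integer points (n ≤ 12): try (i) Kempe /
bracket straightening of Σ_k k!(n−k)!E_k(u,w)E_k(a,b) rewritten in the x_ij with cancellations, (ii)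
gluing two pivot charts
δ₁^n per ≡ Q₁, δ₂^n per ≡ Q₂ by a Bézout/syzygy identity among 2×2 minors modulo I_3, (iii)
expressions in row/column sums, 2×2 minors
and traces. Checked here by hand: every chart-type formula X = U(X)·V(X)ᵀ on D_2 with U polynomial
of degree p and V of degree q over δ^m
has p + q − 2m = 1, hence m ≥ 1 and pole order m·n — a positive multiple of n, never below it;
Laplace-product ansätze Σ_{(S,T)∈F} per(X_{S,T})per(X_{S^c,T^c}) are rectangle-uniform only for the
complete
family (per again), and Strassen's shift p + tX leaves D_2 — so no cheap representative is visible.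
Literature check to run first:
does any published extension of BlaserJindal2019 / CKLMSS Lemma 4 cover algebraically DEPENDENT
quadratic generators (it would prove
¬TransferFailsGLTwo)? None found (arXiv/zbMATH 2026-08-15; Grochow 2020 EATCS column requested,
acq-03375).

NUMBERS. c_1(n) = O(n) (n!·x_11⋯x_nn ≡ per mod I_2); factor-side cost of per(UVᵀ): O(n²)
(Barvinok1996; n^{O(r)} for rank r,
ArvindChatterjeeDattaMukhopadhyay2018); pivot-chart pole order exactly n with L(Q) = O(n²); dim D_2
= 4n−4, dim D_1 = 2n−1, codim of the
singular locus 2n−3 ≥ 2 for n ≥ 3 (Hartogs range), Cl(ℂ[D_2]) = ℤ (BrunsVetter1988); robust sparsity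
floor C(n,⌊n/2⌋) ~ 2ⁿ/√(πn/2)
against per's n! monomials and the n = 3 witness with 3; monotone floor for per itself n(2^{n−1}−1)
⊗-gates (JerrumSnir1982 §4.3,
proved in tree); best upper bound for L(per_n): O(n·2ⁿ) (Ryser), so PoleOrderTradeoff's 2^{Ω(n)} at
N = 0 is consistent with
everything known. Items at open: 11 (1 target, 3 cruxes, 6 support, 1 assembly).

DEFINITION REQUESTS. cosetComplexity (Literature/Computability/AlgebraicComplexity): for an ideal I
≤ MvPolynomial σ k and f, `sInf {complexity P | P - f ∈ I}`
— the representative complexity c_I(f) of the card (c_r(n) := c_{I_{r+1}}(per_n));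
determinantalIdeal r (ideal of the r×r minors of
Matrix.mvPolynomialX m n R), shared vocabulary with Andrews–Forbes-type ideal lower bounds. Both
filed with `ledger workitem add --kind
definition` after open; no item depends on them (all statements are inline).

Novelty: Searches (2026-08-15): `lit search --source arxiv` ×7 ("invariant rings generators hardness
circuits" → arXiv:1910.01251; "Schur
polynomials formulas determinant" → arXiv:1911.12520; "complexity symmetric polynomials elementary",
"division elimination algebraic
variety coordinate ring straight-line program", "permanent rank two matrices polynomial
representative determinantal ideal" → 0 relevant);
`lit search --source zbmath "permanent low rank"` (9 rows: Barvinok math/0503170, ACDM 1808.10787,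
Marcus 2010.08996 — all factor-side
algorithms), `"Vermeidung von Divisionen"` (Strassen1973 only); `lit galaxy search --star all` for
"Vermeidung von Divisionen" (BCS, Landsberg,
von zur Gathen–Gerhard textbooks: affine-space division elimination only), "permanent of low rank
matrices" (0), "division elimination"
(Grochow–Pitassi IPS 2014 only), "Complexity in ideals of polynomials" (0; acq-03375 filed); `lit
frontier ValiantsHypothesis --since 2021`
(30 rows, none on representatives modulo determinantal ideals); `lit bridges ValiantsHypothesis
--cross any`; `lit read arXiv:2112.00792`
(Andrews–Forbes), arXiv:1911.12520 §1, arXiv:1910.01251 §1; grep of all 47 Theses of the sub for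
rank-two/coset/Barvinok/Hartogs (0).
Nearest prior art found: arXiv:2112.00792 (Andrews–Forbes 2022: lower bounds for every nonzero
element of determinantal IDEALS via standard
bideterminants; they note that "the only known lower bounds for nonzero COSETS of ideals are those
that follow from IPS lower bounds  [refs: 1910.01251, 1911.12520, 2112.00792, Strassen1973, Barvinok1996, ArvindChatterjeeDattaMukhopadhyay2018, BlaserJindal2019, ChauguleKumarLimayeMohapatraSheSrinivasan2020, GargIkenmeyerMakamOliveiraWalterWigderson2020]

Barriers (technique_class: coset-avoidance, division-elimination, invariants): - technique_class: coset-avoidance, division-elimination, invariants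
- Literature.Barriers.ValiantsHypothesis.PermanentCharTwo: conceded and used — in characteristic 2,
per = det ∈ I_3 (n ≥ 3), the coset contains 0 and HARTOGS(2) is false for the trivial reason; every
item is stated over ℂ (RobustMonotoneRung over ℝ≥0), nothing is characteristic-free.
- Literature.Barriers.ValiantsHypothesis.RankMethods: the engine (PoleOrderTradeoff: pole order of
representatives along D_1) and the kill switch (TransferFailsGLTwo) are not sub-additive rank
measures; a flattening appears only in the unfiled Nisan rung, for a restricted model where it is a
theorem-grade tool, never as the route's lower-bound method for general circuits.
- Literature.Barriers.ValiantsHypothesis.AlgebraicNaturalProofs: "every element of per + I_3 is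
hard" is a statement about an affine subspace of coefficient space of dimension dim (I_3)_{≤d}, not
a polynomial distinguisher vanishing on all small circuits; it is non-large and non-constructive by
design, so FSV/GKSS does not formally apply — the bet is that coset structure (straightening, pole
order) substitutes for largeness.
- Literature.Barriers.ValiantsHypothesis.MonotoneGap: RobustMonotoneRung is a rung, not a transfer:
no inference from monotone to general complexity is drawn (HartogsTwo is argued through
PoleOrderTradeoff); the monotone statement is itself new only in its robustness over the coset.
- Literature.Barriers.ValiantsHypothesis.NoncommutativeExt

sub-problem: ValiantsHypothesis · status: done · opened planner-plancard-ValiantsHypothesis-ValiantsH-41b08565-0 2026-08-15T16:10:51Z · rev 0 · ledger route-ValiantsHypothesis-HartogsRankTwo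
GENERATED by the gate from the ledger (D-0016/17). Provers cite these decls: `theorem foo : Summit.ValiantsHypothesis.ValiantsHypothesis.Theses.HartogsRankTwo.<Decl> := …` in Summits/ValiantsHypothesis/ValiantsHypothesis/Theorems/<Name>.lean.
-/

namespace Summit.ValiantsHypothesis.ValiantsHypothesis.Theses.HartogsRankTwo

open scoped BigOperators Topology Manifold Classical MeasureTheory ProbabilityTheory Matrix InnerProductSpace ComplexConjugate ContinuousMap
open Filter Set Function TopologicalSpace MeasureTheory

attribute [summit_statement] _root_.ValiantsHypothesis

open Literature.PNP

/-- item stmt-ValiantsHypothesis-10329 · target · rank 0 · open · by planner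
why it might fail: One poly-size division-free SLP agreeing with per_n on rank-2 matrices kills it: Kempe/bracket straightening of the transvectant Σ_k k!(n−k)!E_k(u,w)E_k(a,b) with cancellations, or gluing the O(n⁴) pivot charts by a syzygy of the 2×2 minors.
sources: Barvinok1996, ArvindChatterjeeDattaMukhopadhyay2018, Strassen1973, BlaserJindal2019, arXiv:2112.00792
[target] HARTOGS(2): there is no c such that for every n some polynomial P with L(P) ≤ n^c + c
agrees with per_n on all rank-≤2 matrices U Vᵀ (U, V ∈ ℂ^{n×2}); i.e. the representative complexity
c_2(n) = min{L(P) : P ≡ per_n mod I_3} is not p-bounded (card K1). -/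
@[route_item "route-ValiantsHypothesis-HartogsRankTwo", crux]
def HartogsTwo : Prop :=
  ¬ ∃ c : ℕ, ∀ n : ℕ, ∃ P : MvPolynomial (Fin n × Fin n) ℂ, (∀ U V : Fin n → Fin 2 → ℂ, MvPolynomial.eval (fun ij : Fin n × Fin n => ∑ t : Fin 2, U ij.1 t * V ij.2 t) P = MvPolynomial.eval (fun ij : Fin n × Fin n => ∑ t : Fin 2, U ij.1 t * V ij.2 t) (Literature.Computability.AlgebraicComplexity.perPoly (Fin n) ℂ)) ∧ Literature.Computability.AlgebraicComplexity.complexity P ≤ n ^ c + c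

/-- item stmt-ValiantsHypothesis-10330 · crux · rank 2 · open · by planner
why it might fail: Claims 2^{Ω(n−N)}, i.e. exponential (not just superpolynomial) hardness at N=0; a partial-fraction/syzygy identity among the C(n,2)² pivot charts (each of pole order exactly n: bidegree count p+q−2m=1) might lower N in big steps at polynomial cost.
sources: Strassen1973, Kaltofen1989, BrunsVetter1988, arXiv:2112.00792, Barvinok1996
[crux] POLE-ORDER/SIZE TRADEOFF along D_1 (card K2, the quantitative engine): there is C such that
for all n, N and every polynomial Q on (n+2)×(n+2) matrices agreeing with δ^N·per_{n+2} on D_2,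
where δ = x_00x_11 − x_01x_10 is the pivot minor, one has n ≤ N + C·(log₂ L(Q) + 1) — lowering the
pole order along D_1 by t below the chart value costs size 2^{Ω(t)}; at N = 0 every representative
of per has size 2^{Ω(n)}, so this implies HartogsTwo (support TradeoffToHartogs). [difficulty:
open-problem] -/
@[route_item "route-ValiantsHypothesis-HartogsRankTwo", crux]
def PoleOrderTradeoff : Prop :=
  ∃ C : ℕ, ∀ n N : ℕ, ∀ Q : MvPolynomial (Fin (n + 2) × Fin (n + 2)) ℂ, (∀ U V : Fin (n + 2) → Fin 2 → ℂ, MvPolynomial.eval (fun ij : Fin (n + 2) × Fin (n + 2) => ∑ t : Fin 2, U ij.1 t * V ij.2 t) Q = MvPolynomial.eval (fun ij : Fin (n + 2) × Fin (n + 2) => ∑ t : Fin 2, U ij.1 t * V ij.2 t) ((MvPolynomial.X (0, 0) * MvPolynomial.X (1, 1) - MvPolynomial.X (0, 1) * MvPolynomial.X (1, 0)) ^ N * Literature.Computability.AlgebraicComplexity.perPoly (Fin (n + 2)) ℂ)) → n ≤ N + C * (Nat.log 2 (Literature.Computability.AlgebraicComplexity.complexity Q) + 1)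

/-- item stmt-ValiantsHypothesis-10331 · crux · rank 3 · open · by planner
why it might fail: A transfer theorem for the dependent generators x_ij=⟨u_i,v_j⟩ — Newton iteration along smooth points of D_2 plus a cheap Hartogs extension across D_1 (codim 2n−3; ℂ[D_2] is normal Cohen–Macaulay with explicit straightening) — would refute it.
sources: BlaserJindal2019, ChauguleKumarLimayeMohapatraSheSrinivasan2020, GargIkenmeyerMakamOliveiraWalterWigderson2020, Weyl1939, Strassen1973
[crux] GL_2 TRANSFER FAILS (the isolated phenomenon; its negation is a Bläser–Jindal-type transfer
theorem for the reductive group GL_2 and kills the route): there is a p-family F_n ∈ ℂ[X_n] of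
p-bounded degree whose pullback F_n(U Vᵀ) ∈ ℂ[U,V] (a GL_2-invariant, U,V ∈ ℂ^{n×2}) has p-bounded
circuit complexity, while no p-bounded family of polynomials in X agrees with F_n on D_2. Implied by
HartogsTwo ∧ FactorSideEasy with F = per. [difficulty: open-problem] -/
@[route_item "route-ValiantsHypothesis-HartogsRankTwo", crux]
def TransferFailsGLTwo : Prop :=
  ∃ F : (n : ℕ) → MvPolynomial (Fin n × Fin n) ℂ, Literature.Computability.AlgebraicComplexity.IsPBounded (fun n => (F n).totalDegree) ∧ Literature.Computability.AlgebraicComplexity.IsPBounded (fun n => Literature.Computability.AlgebraicComplexity.complexity (MvPolynomial.bind₁ (fun ij : Fin n × Fin n => ∑ t : Fin 2, (MvPolynomial.X (Sum.inl (ij.1, t)) * MvPolynomial.X (Sum.inr (ij.2, t)) : MvPolynomial ((Fin n × Fin 2) ⊕ (Fin n × Fin 2)) ℂ)) (F n))) ∧ ¬ ∃ c : ℕ, ∀ n : ℕ, ∃ P : MvPolynomial (Fin n × Fin n) ℂ, (∀ U V : Fin n → Fin 2 → ℂ, MvPolynomial.eval (fun ij : Fin n × Fin n => ∑ t : Fin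 2, U ij.1 t * V ij.2 t) P = MvPolynomial.eval (fun ij : Fin n × Fin n => ∑ t : Fin 2, U ij.1 t * V ij.2 t) (F n)) ∧ Literature.Computability.AlgebraicComplexity.complexity P ≤ n ^ c + c

/-- item stmt-ValiantsHypothesis-10332 · crux · rank 4 · open · by planner
why it might fail: A structured rectangle-uniform p ≥ 0 (iterated-wreath or design-like support of size ~C(n,n/2)·poly) might let parse trees be shared below 2^{εn}; JS's content argument is proved only for supp p = S_n (per) and HC.
sources: JerrumSnir1982, doi:10.1016/s0304-3975(98)00130-3, Valiant1980, arXiv:2112.00792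
[crux] ROBUST JERRUM–SNIR (card K3, the monotone rung of the coset): there are ε > 0 and n₀ such
that for n ≥ n₀, every Jerrum–Snir monotone computation (plain ⊕/⊗ circuit over ℝ≥0) of a polynomial
f ∈ ℝ≥0[X_n] that agrees with per_n on all NONNEGATIVE rank-≤2 matrices has ⊗-count ≥ 2^{εn}. For f
= per_n this is the proved cone fact JerrumSnir1982_permanent (n(2^{n−1}−1)); nonnegative
representatives are exactly the GMFs d_p with p ≥ 0 rectangle-uniform (e.g. per + det = 2·Σ_{A_n}),
so the claim is a content bound uniform over that polytope. [deps: RectangleCriterion] [difficulty: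
L] -/
@[route_item "route-ValiantsHypothesis-HartogsRankTwo", crux]
def RobustMonotoneRung : Prop :=
  ∃ ε : ℝ, 0 < ε ∧ ∃ n₀ : ℕ, ∀ n : ℕ, n₀ ≤ n → ∀ (f : MvPolynomial (Fin n × Fin n) NNReal) (P : Literature.Computability.AlgebraicComplexity.ArithCircuit NNReal (Fin n × Fin n)), (∀ U V : Fin n → Fin 2 → NNReal, MvPolynomial.eval (fun ij : Fin n × Fin n => ∑ t : Fin 2, U ij.1 t * V ij.2 t) f = MvPolynomial.eval (fun ij : Fin n × Fin n => ∑ t : Fin 2, U ij.1 t * V ij.2 t) (Literature.Computability.AlgebraicComplexity.perPoly (Fin n) NNReal)) → Literature.Barriers.ValiantsHypothesis.IsMonotoneComputation P f → (2 : ℝ) ^ (ε * n) ≤ Literature.Barriers.ValiantsHypothesis.prodCount P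

/-- item stmt-ValiantsHypothesis-10333 · support · rank 9 · closed · proved by Summit.ValiantsHypothesis.ValiantsHypothesis.Theorems.HartogsRankTwo.rectangleCriterion_proof (prover) · by planner
sources: Barvinok1996, MarcusMinc1961
[support] (card P1, elementary form) a generalized matrix function d_q = Σ_σ q(σ) Π_i x_{σ(i),i}
vanishes on D_2 iff every rectangle sum Σ_{σ : σ(A) = B} q(σ) (|A| = |B|) vanishes — the coefficient
of a_A b_{A^c} u_B w_{B^c} in d_q(UVᵀ) is exactly that sum. Hence P ≡ per mod I_3 forces the
(1ⁿ,1ⁿ)-weight part d_p of P to have all k-rectangle sums equal to k!(n−k)!. [difficulty: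
provable-now] -/
@[route_item "route-ValiantsHypothesis-HartogsRankTwo", crux]
def RectangleCriterion : Prop :=
  ∀ (n : ℕ) (q : Equiv.Perm (Fin n) → ℂ), (∀ U V : Fin n → Fin 2 → ℂ, MvPolynomial.eval (fun ij : Fin n × Fin n => ∑ t : Fin 2, U ij.1 t * V ij.2 t) (∑ σ : Equiv.Perm (Fin n), MvPolynomial.C (q σ) * ∏ i : Fin n, MvPolynomial.X (σ i, i)) = 0) ↔ ∀ A B : Finset (Fin n), A.card = B.card → ∑ σ ∈ Finset.univ.filter (fun σ : Equiv.Perm (Fin n) => A.map σ.toEmbedding = B), q σ = 0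

-- `RectangleCriterion` holds: proved by `Summit.ValiantsHypothesis.ValiantsHypothesis.Theorems.HartogsRankTwo.rectangleCriterion_proof` (its module imports this route file, so no `_holds` link can be stated here).

/-- item stmt-ValiantsHypothesis-10334 · support · rank 9 · closed · proved by Summit.ValiantsHypothesis.ValiantsHypothesis.Theorems.HartogsRankTwo.robustSparsity_proof (prover) · by planner
sources: arXiv:2112.00792, JerrumSnir1982, MarcusMinc1961
[support] (card P2) every polynomial agreeing with per_n on D_2 has at least C(n,⌊n/2⌋) monomials:
I(D_2) is homogeneous for the row/column torus grading, so the (1ⁿ,1ⁿ)-weight part of P is a GMF d_p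
≡ per mod I_3; by RectangleCriterion, for a fixed ⌊n/2⌋-set A the images σ(A), σ ∈ supp p, cover all
⌊n/2⌋-sets (tight at n = 3: 2(x_12x_21x_33 + x_13x_22x_31 + x_11x_23x_32) = per − det). [difficulty:
provable-now] -/
@[route_item "route-ValiantsHypothesis-HartogsRankTwo", crux]
def RobustSparsity : Prop :=
  ∀ (n : ℕ) (P : MvPolynomial (Fin n × Fin n) ℂ), (∀ U V : Fin n → Fin 2 → ℂ, MvPolynomial.eval (fun ij : Fin n × Fin n => ∑ t : Fin 2, U ij.1 t * V ij.2 t) P = MvPolynomial.eval (fun ij : Fin n × Fin n => ∑ t : Fin 2, U ij.1 t * V ij.2 t) (Literature.Computability.AlgebraicComplexity.perPoly (Fin n) ℂ)) → n.choose (n / 2) ≤ P.support.card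

-- `RobustSparsity` holds: proved by `Summit.ValiantsHypothesis.ValiantsHypothesis.Theorems.HartogsRankTwo.robustSparsity_proof` (its module imports this route file, so no `_holds` link can be stated here).

/-- item stmt-ValiantsHypothesis-10335 · support · rank 9 · closed · proved by Summit.ValiantsHypothesis.ValiantsHypothesis.Theorems.HartogsRankTwo.factorSideEasy_proof (prover) · by planner
sources: Barvinok1996, ArvindChatterjeeDattaMukhopadhyay2018, Burgisser2000
[support] (card P4a, the RATIONALLY-EASY half; Barvinok's rank-two permanent) the pullback per_n(U
Vᵀ) ∈ ℂ[U,V] = Σ_k k!(n−k)!·E_k(u,w)·E_k(a,b), E_k(u,w) = [s^k]Π_i(s·u_i + w_i), has p-bounded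
circuit complexity (size O(n²)). [difficulty: M] -/
@[route_item "route-ValiantsHypothesis-HartogsRankTwo", crux]
def FactorSideEasy : Prop :=
  Literature.Computability.AlgebraicComplexity.IsPBounded (fun n => Literature.Computability.AlgebraicComplexity.complexity (MvPolynomial.bind₁ (fun ij : Fin n × Fin n => ∑ t : Fin 2, (MvPolynomial.X (Sum.inl (ij.1, t)) * MvPolynomial.X (Sum.inr (ij.2, t)) : MvPolynomial ((Fin n × Fin 2) ⊕ (Fin n × Fin 2)) ℂ)) (Literature.Computability.AlgebraicComplexity.perPoly (Fin n) ℂ)))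

-- `FactorSideEasy` holds: proved by `Summit.ValiantsHypothesis.ValiantsHypothesis.Theorems.HartogsRankTwo.factorSideEasy_proof` (its module imports this route file, so no `_holds` link can be stated here).

/-- item stmt-ValiantsHypothesis-10336 · support · rank 9 · closed · proved by Summit.ValiantsHypothesis.ValiantsHypothesis.Theorems.HartogsRankTwo.pivotChart_proof (prover) · by planner
sources: Barvinok1996, Strassen1973, Burgisser2000
[support] (card P4b, the chart) pivoting on δ = x_00x_11 − x_01x_10: with U' = X_{·,{0,1}} and V'ᵀ =
adj(X_{{0,1},{0,1}})·X_{{0,1},·}, the polynomial Q = Σ_k k!(n+2−k)!·E_k(U')·E_k(V') has circuit size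
poly(n) and agrees with δ^{n+2}·per_{n+2} on D_2 (on δ ≠ 0 by X = U'(X_{01,01})^{-1}X_{01,·}, then
by density); so the pole order n+2 is attained cheaply and PoleOrderTradeoff is sharp at its top.
[difficulty: M] -/
@[route_item "route-ValiantsHypothesis-HartogsRankTwo", crux]
def PivotChart : Prop :=
  ∃ c : ℕ, ∀ n : ℕ, ∃ Q : MvPolynomial (Fin (n + 2) × Fin (n + 2)) ℂ, (∀ U V : Fin (n + 2) → Fin 2 → ℂ, MvPolynomial.eval (fun ij : Fin (n + 2) × Fin (n + 2) => ∑ t : Fin 2, U ij.1 t * V ij.2 t) Q = MvPolynomial.eval (fun ij : Fin (n + 2) × Fin (n + 2) => ∑ t : Fin 2, U ij.1 t * V ij.2 t) ((MvPolynomial.X (0, 0) * MvPolynomial.X (1, 1) - MvPolynomial.X (0, 1) * MvPolynomial.X (1, 0)) ^ (n + 2) * Literature.Computability.AlgebraicComplexity.perPoly (Fin (n + 2)) ℂ)) ∧ Literature.Computability.AlgebraicComplexity.complexity Q ≤ n ^ c + c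

-- `PivotChart` holds: proved by `Summit.ValiantsHypothesis.ValiantsHypothesis.Theorems.HartogsRankTwo.pivotChart_proof` (its module imports this route file, so no `_holds` link can be stated here).

/-- item stmt-ValiantsHypothesis-10337 · support · rank 9 · closed · proved by Summit.ValiantsHypothesis.ValiantsHypothesis.Theorems.HartogsRankTwo.kernelIsMinors_proof (prover) · by planner
sources: BrunsVetter1988, DeConciniEisenbudProcesi1980, HochsterEagon1971, Weyl1939
[support] (dictionary to the card's ideal language; Second Fundamental Theorem for GL_2 = primality
of I_3, Hochster–Eagon / De Concini–Eisenbud–Procesi / Bruns–Vetter Thm 2.10) a polynomial vanishes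
on D_2 = {U Vᵀ} iff it lies in the ideal generated by the 3×3 minors of the generic n×n matrix; so
"agrees with per on D_2" = "≡ per mod I_3" throughout the route. [difficulty: L] -/
@[route_item "route-ValiantsHypothesis-HartogsRankTwo", crux]
def KernelIsMinors : Prop :=
  ∀ (n : ℕ) (P : MvPolynomial (Fin n × Fin n) ℂ), (∀ U V : Fin n → Fin 2 → ℂ, MvPolynomial.eval (fun ij : Fin n × Fin n => ∑ t : Fin 2, U ij.1 t * V ij.2 t) P = 0) ↔ P ∈ Ideal.span (Set.range fun rc : (Fin 3 → Fin n) × (Fin 3 → Fin n) => ((Matrix.mvPolynomialX (Fin n) (Fin n) ℂ).submatrix rc.1 rc.2).det)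

-- `KernelIsMinors` holds: proved by `Summit.ValiantsHypothesis.ValiantsHypothesis.Theorems.HartogsRankTwo.kernelIsMinors_proof` (its module imports this route file, so no `_holds` link can be stated here).

/-- item stmt-ValiantsHypothesis-10338 · support · rank 9 · closed · proved by Summit.ValiantsHypothesis.ValiantsHypothesis.Theorems.HartogsRankTwo.tradeoffToHartogs_proof (prover) · by planner
sources: Burgisser2000
[support] (glue) PoleOrderTradeoff at pole order N = 0 and size n+2 bounds every representative of
per_{n+2} below by 2^{n/C−1}, which beats (n+2)^c + c eventually; hence HartogsTwo. [difficulty: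
provable-now] -/
@[route_item "route-ValiantsHypothesis-HartogsRankTwo", crux]
def TradeoffToHartogs : Prop :=
  PoleOrderTradeoff → HartogsTwo

-- `TradeoffToHartogs` holds: proved by `Summit.ValiantsHypothesis.ValiantsHypothesis.Theorems.HartogsRankTwo.tradeoffToHartogs_proof` (its module imports this route file, so no `_holds` link can be stated here).

/-- item stmt-ValiantsHypothesis-10339 · assembly · rank 1 · closed · proved by Summit.ValiantsHypothesis.ValiantsHypothesis.Theorems.HartogsRankTwo.assembly_proof (prover) · by planner
sources: Valiant1979, Burgisser2000
[assembly] HartogsTwo → ValiantsHypothesis (per lies in its own coset; hub). -/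
@[route_item "route-ValiantsHypothesis-HartogsRankTwo", crux]
def Assembly : Prop :=
  HartogsTwo → _root_.ValiantsHypothesis

-- `Assembly` holds: proved by `Summit.ValiantsHypothesis.ValiantsHypothesis.Theorems.HartogsRankTwo.assembly_proof` (its module imports this route file, so no `_holds` link can be stated here).

/-! D-0027 §2.1 — DECIDING THEOREM (planner-authored via `route open/edit --closes-file`; by planner-plancard-ValiantsHypothesis-ValiantsH-41b08565-0 2026-08-15T16:10:52Z):
its hypotheses are this route's items and its conclusion the sub-problem Statement (glue_lint), and it elaborates with this file. -/

@[closes "route-ValiantsHypothesis-HartogsRankTwo"] theorem closes : HartogsTwo → PoleOrderTradeoff → TransferFailsGLTwo → RobustMonotoneRung → RectangleCriterion → RobustSparsity → FactorSideEasy → PivotChart → KernelIsMinors → TradeoffToHartogs → Assembly → _root_.ValiantsHypothesis := by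
  intro hX _ _ _ _ _ _ _ _ _ _
  refine Summit.ValiantsHypothesis.Hub.valiantsHypothesis_of_not_isVPFamily_per ?_
    (Literature.Computability.AlgebraicComplexity.mem_VP_ofFintype_iff_holds _)
    (Literature.Computability.AlgebraicComplexity.perFamily_mem_VNP_holds ℂ)
  rintro ⟨-, c, hc⟩
  exact hX ⟨c, fun n => ⟨_, fun _ _ => rfl, hc n⟩⟩

end Summit.ValiantsHypothesis.ValiantsHypothesis.Theses.HartogsRankTwo
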